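import Summits.Ventures.QEC.Census.CertCheck
import Summits.Ventures.QEC.Census.Bits
import Literature.InformationTheory.QuantumCodes.SyndromeDecodingCSS
import HarnessLib

/-!
# Ventures/QEC — Decoders/RadiusCheck: the kernel end of a RADIUS certificate (qec PARTITION row 08)

HONEST FRAMING: CERTIFIED column only. This file turns an explicit table decoder for one error type
of a CSS code (search-6's `qec-radius-data-v0` tables, emitted into Lean by search-7) plus finitely
many word-level checks into the kernel statement
`D.CorrectsUpTo C.xSyndrome ↑C.rowSpX hammingNorm t` of
`Literature/InformationTheory/QuantumCodes/SyndromeDecoding{,CSS}.lean` ("`D` corrects every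
`X`-error of weight `≤ t`"), for the SAME code object `c.code` that the distance certificate
(`Census/CertCheck.lean`, type-10) speaks about. Nothing probabilistic; no performance claim.

Representation = the certificate checker's (`Census/CertBits.lean`, `Census/CertScan.lean`):
qubit words and check rows are `Nat` bitmasks, `Census.rowMatrix n H` is the check matrix of a row
list, `Census.scan` is the structural include/skip enumeration of all supports of weight `≤ t`
(completeness `Census.scan_sublist`), and `Summit.Ventures.QEC.toBits` (`Census/Bits.lean`,
type-01) keys a syndrome vector by its numeral.

* `tableDecoder n m T` — the decoder `(Fin m → ZMod 2) → (Fin n → ZMod 2)` reading the table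
  `T : List (ℕ × ℕ)` of (syndrome word, correction word) pairs, trivial correction on unlisted
  syndromes (the word-level form of `Decoder.ofTable`).
* ROUTE T — `checkRadiusT n Hsyn T t`: for every word `e` of weight `≤ t` (enumerated by `scan`
  with its true `Hsyn`-syndrome word `s`), the table answer `c = T(s)` has syndrome word `s` and
  weight `≤ t`. SOUNDNESS `correctsUpToX_of_checkRadiusT`: together with `2t < d^X` the table
  decoder corrects every `X`-error of weight `≤ t` (bounded-distance decoding,
  `CSSCode.correctsUpToX_of_boundedDistance`); `DistCert.correctsUpToX_of_checkRadiusT` takes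
  `2t < c.dX` straight from a checked distance certificate (`DistCert.dX_code`).
* ROUTE E — `checkRadiusE n Hsyn Hstab T E t`: for every word `e` of weight `≤ t` the residual
  `T(s) ⊕ e` is the XOR of the stabilizer rows selected by `E(e)` (an explicit row-combination
  certificate per error; needed for decoders whose corrections are right only up to stabilizers,
  e.g. MWPM on the toric code). SOUNDNESS `correctsUpToX_of_checkRadiusE`: the table decoder
  corrects every `X`-error of weight `≤ t`, with NO distance hypothesis.
* EXACTNESS — `checkFailX`: one error word of weight `≤ t + 1` whose residual has odd overlap with
  a vector `u` orthogonal to all stabilizer rows (`Census.synZero n Hstab u`) refutes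
  `CorrectsUpTo (t+1)` (`not_mem_rowSpace_of_witness`); with a passed route-T check this gives the
  exact radius `IsCorrectionRadius … t` (`isCorrectionRadiusX_of_checks`).
* `Z`-sector statements are the `X`-sector statements of the exchanged row lists (`CSSCode.swap`).

Tier: `decide` (KERNEL) for small tables, `native_decide` (COMPILED, `--computational`) for e.g.
[[72,12,6]] at `t = 2` (2 × 2629 leaves); the checks are allocation-light (`Nat` bit operations,
linear `List.lookup`). Sources of the statements: the decoding vocabulary files cited there
(Nielsen–Chuang §10.5.5, Ryan–Lin–Wilson §3.1.4, Delfosse–Nickerson §3).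
-/

namespace Summit.Ventures.QEC.Decoders

open Matrix Literature.InformationTheory.QuantumCodes

/-! ## Words, syndromes, the table decoder -/

/-- The two bit layers of the tree agree: `Census.ofBits` (type-10) is `Summit.Ventures.QEC.ofBits`
(type-01), definitionally. -/
theorem census_ofBits_eq (n w : ℕ) : Census.ofBits n w = ofBits n w := rfl

/-- The **syndrome word** of the correction word `c` with respect to the row list `H` on `n` qubits:
the numeral of `H · ofBits n c` (computed as the XOR of the column masks over the support of `c`). -/
def synWordOf (n : ℕ) (H : List ℕ) (c : ℕ) : ℕ := Census.xorSnd (Census.suppList n H (Census.ofBits n c))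

/-- The syndrome word is the syndrome: `ofBits |H| (synWordOf n H c) = H · ofBits n c`. -/
theorem ofBits_synWordOf (n : ℕ) (H : List ℕ) (c : ℕ) :
    Census.ofBits H.length (synWordOf n H c) = Census.rowMatrix n H *ᵥ Census.ofBits n c :=
  Census.ofBits_xorSnd_suppList n H _

/-- Syndrome words of support lists are `< 2^|H|`. -/
theorem xorSnd_suppList_lt (n : ℕ) (H : List ℕ) (w : Fin n → ZMod 2) :
    Census.xorSnd (Census.suppList n H w) < 2 ^ H.length := by
  refine Census.xorList_lt _ _ fun x hx => ?_
  simp only [Census.suppList, List.map_map, List.mem_map] at hx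
  obtain ⟨j, -, rfl⟩ := hx
  exact Census.colMask_lt H j

/-- The numeral of the syndrome `H e` is the syndrome word of the support list of `e`. -/
theorem toBits_mulVec_eq_xorSnd (n : ℕ) (H : List ℕ) (e : Fin n → ZMod 2) :
    toBits (Census.rowMatrix n H *ᵥ e) = Census.xorSnd (Census.suppList n H e) := by
  rw [← Census.ofBits_xorSnd_suppList n H e, census_ofBits_eq]
  exact toBits_ofBits (xorSnd_suppList_lt n H e)

/-- The numeral of the syndrome of a correction word is its syndrome word. -/
theorem toBits_mulVec_ofBits (n : ℕ) (H : List ℕ) (c : ℕ) :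
    toBits (Census.rowMatrix n H *ᵥ Census.ofBits n c) = synWordOf n H c :=
  toBits_mulVec_eq_xorSnd n H _

/-- The **table decoder on words**: key the syndrome `σ : Fin m → ZMod 2` by its numeral, look it up
in the table `T` of (syndrome word, correction word) pairs, return the correction word as a vector;
unlisted syndromes get the trivial correction (word `0`). This is the word-level form of
`Decoder.ofTable` (`Literature/…/TableDecoder.lean`) that certificate files use. -/
def tableDecoder (n m : ℕ) (T : List (ℕ × ℕ)) : Decoder (Fin m → ZMod 2) (Fin n → ZMod 2) :=
  fun σ => Census.ofBits n ((T.lookup (toBits σ)).getD 0)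

/-- The table decoder on a true syndrome `H e` answers with the word stored under the syndrome word
of `e`'s support list. -/
theorem tableDecoder_mulVec (n : ℕ) (H : List ℕ) (T : List (ℕ × ℕ)) (e : Fin n → ZMod 2) :
    tableDecoder n H.length T (Census.rowMatrix n H *ᵥ e) =
      Census.ofBits n ((T.lookup (Census.xorSnd (Census.suppList n H e))).getD 0) := by
  rw [tableDecoder, toBits_mulVec_eq_xorSnd]

/-! ## Route T: bounded-distance table check -/

/-- Leaf test of route T at (error word `v`, its syndrome word `s`): the table answer `c = T(s)` has
syndrome word `s` and weight `≤ t`. (`v` itself is not needed.) -/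
def leafT (n : ℕ) (Hsyn : List ℕ) (T : List (ℕ × ℕ)) (t : ℕ) (_v s : ℕ) : Bool :=
  (synWordOf n Hsyn ((T.lookup s).getD 0) == s) && (Census.popc n ((T.lookup s).getD 0)).ble t

/-- **Route-T radius check**: every word of weight `≤ t` on `n` qubits, with its true `Hsyn`-syndrome,
passes `leafT`. -/
def checkRadiusT (n : ℕ) (Hsyn : List ℕ) (T : List (ℕ × ℕ)) (t : ℕ) : Bool :=
  Census.scan (leafT n Hsyn T t) (Census.posList n Hsyn) t 0 0

/-- What a passed route-T check says about an arbitrary error `e` of weight `≤ t`: the table answer on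
the syndrome `Hsyn e` has the same syndrome and weight `≤ t`. -/
theorem leafT_sound {n : ℕ} {Hsyn : List ℕ} {T : List (ℕ × ℕ)} {t : ℕ}
    (h : checkRadiusT n Hsyn T t = true) (e : Fin n → ZMod 2) (he : hammingNorm e ≤ t) :
    Census.rowMatrix n Hsyn *ᵥ tableDecoder n Hsyn.length T (Census.rowMatrix n Hsyn *ᵥ e) =
        Census.rowMatrix n Hsyn *ᵥ e ∧
      hammingNorm (tableDecoder n Hsyn.length T (Census.rowMatrix n Hsyn *ᵥ e)) ≤ t := by
  have hS := Census.scan_sublist _ _ _ _ _ h (Census.suppList n Hsyn e)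
    (Census.suppList_sublist n Hsyn e) (by rw [Census.length_suppList]; exact he)
  rw [Nat.zero_xor, Nat.zero_xor, leafT, Bool.and_eq_true, beq_iff_eq, Nat.ble_eq] at hS
  obtain ⟨hsyn, hwt⟩ := hS
  rw [tableDecoder_mulVec]
  refine ⟨?_, by rw [Census.hammingNorm_ofBits]; exact hwt⟩
  rw [← ofBits_synWordOf, hsyn, Census.ofBits_xorSnd_suppList]

/-- **Soundness of route T (`X`-sector).** For the CSS code with check rows `HX`, `HZ` (words on `n`
qubits), a passed `checkRadiusT n HZ T t` and `2t < d^X` give: the table decoder of `T` corrects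
every `X`-error of weight `≤ t` (residual in the row space of `H^X`). -/
theorem correctsUpToX_of_checkRadiusT {n : ℕ} {HX HZ : List ℕ}
    (hcomm : Census.rowMatrix n HX * (Census.rowMatrix n HZ)ᵀ = 0) {T : List (ℕ × ℕ)} {t : ℕ}
    (h : checkRadiusT n HZ T t = true)
    (hd : 2 * t < (CSSCode.ofMatrices (Census.rowMatrix n HX) (Census.rowMatrix n HZ) hcomm).dX) :
    (tableDecoder n HZ.length T).CorrectsUpTo
      (CSSCode.ofMatrices (Census.rowMatrix n HX) (Census.rowMatrix n HZ) hcomm).xSyndrome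
      ((CSSCode.ofMatrices (Census.rowMatrix n HX) (Census.rowMatrix n HZ) hcomm).rowSpX :
        Set (Fin n → ZMod 2)) hammingNorm t :=
  CSSCode.correctsUpToX_of_boundedDistance _ (fun e he => (leafT_sound h e he).1)
    (fun e he => (leafT_sound h e he).2) hd

/-- **Soundness of route T (`Z`-sector)**: the same with the rows exchanged (`checkRadiusT n HX T t`,
`2t < d^Z`, residual in the row space of `H^Z`). -/
theorem correctsUpToZ_of_checkRadiusT {n : ℕ} {HX HZ : List ℕ}
    (hcomm : Census.rowMatrix n HX * (Census.rowMatrix n HZ)ᵀ = 0) {T : List (ℕ × ℕ)} {t : ℕ}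
    (h : checkRadiusT n HX T t = true)
    (hd : 2 * t < (CSSCode.ofMatrices (Census.rowMatrix n HX) (Census.rowMatrix n HZ) hcomm).dZ) :
    (tableDecoder n HX.length T).CorrectsUpTo
      (CSSCode.ofMatrices (Census.rowMatrix n HX) (Census.rowMatrix n HZ) hcomm).zSyndrome
      ((CSSCode.ofMatrices (Census.rowMatrix n HX) (Census.rowMatrix n HZ) hcomm).rowSpZ :
        Set (Fin n → ZMod 2)) hammingNorm t :=
  correctsUpToX_of_checkRadiusT
    (CSSCode.ofMatrices (Census.rowMatrix n HX) (Census.rowMatrix n HZ) hcomm).swap.comm h hd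

/-! ## Route E: explicit residual certificates -/

/-- Leaf test of route E at (error word `v`, syndrome word `s`): the certificate table `E` lists, under
`v`, indices of stabilizer rows whose XOR is the residual `T(s) ⊕ v`. -/
def leafE (n : ℕ) (Hstab : List ℕ) (T : List (ℕ × ℕ)) (E : List (ℕ × List ℕ)) (v s : ℕ) : Bool :=
  match E.lookup v with
  | none => false
  | some sel => Census.xorRows Hstab sel == (((T.lookup s).getD 0) ^^^ v) && (v < 2 ^ n : Bool)

/-- **Route-E radius check**: every word of weight `≤ t`, with its true `Hsyn`-syndrome, passes
`leafE` against the stabilizer rows `Hstab`. -/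
def checkRadiusE (n : ℕ) (Hsyn Hstab : List ℕ) (T : List (ℕ × ℕ)) (E : List (ℕ × List ℕ)) (t : ℕ) :
    Bool :=
  Census.scan (leafE n Hstab T E) (Census.posList n Hsyn) t 0 0

/-- What a passed route-E check says about an arbitrary error `e` of weight `≤ t`: the residual
`D(H e) + e` lies in the row space of `Hstab`. -/
theorem leafE_sound {n : ℕ} {Hsyn Hstab : List ℕ} {T : List (ℕ × ℕ)} {E : List (ℕ × List ℕ)} {t : ℕ}
    (h : checkRadiusE n Hsyn Hstab T E t = true) (e : Fin n → ZMod 2) (he : hammingNorm e ≤ t) :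
    tableDecoder n Hsyn.length T (Census.rowMatrix n Hsyn *ᵥ e) + e ∈
      rowSpace (Census.rowMatrix n Hstab) := by
  have hS := Census.scan_sublist _ _ _ _ _ h (Census.suppList n Hsyn e)
    (Census.suppList_sublist n Hsyn e) (by rw [Census.length_suppList]; exact he)
  rw [Nat.zero_xor, Nat.zero_xor, leafE] at hS
  cases hl : E.lookup (Census.xorFst (Census.suppList n Hsyn e)) with
  | none => rw [hl] at hS; exact Bool.noConfusion hS
  | some sel =>
    rw [hl] at hS
    simp only [Bool.and_eq_true, beq_iff_eq, decide_eq_true_eq] at hS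
    have key := Census.ofBits_xorRows_mem_rowSpace n Hstab sel
    rw [hS.1, Census.ofBits_xor, Census.ofBits_xorFst_suppList] at key
    rw [tableDecoder_mulVec]
    exact key

/-- **Soundness of route E (`X`-sector)**, no distance hypothesis: a passed
`checkRadiusE n HZ HX T E t` gives: the table decoder of `T` corrects every `X`-error of weight `≤ t`. -/
theorem correctsUpToX_of_checkRadiusE {n : ℕ} {HX HZ : List ℕ}
    (hcomm : Census.rowMatrix n HX * (Census.rowMatrix n HZ)ᵀ = 0) {T : List (ℕ × ℕ)}
    {E : List (ℕ × List ℕ)} {t : ℕ} (h : checkRadiusE n HZ HX T E t = true) :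
    (tableDecoder n HZ.length T).CorrectsUpTo
      (CSSCode.ofMatrices (Census.rowMatrix n HX) (Census.rowMatrix n HZ) hcomm).xSyndrome
      ((CSSCode.ofMatrices (Census.rowMatrix n HX) (Census.rowMatrix n HZ) hcomm).rowSpX :
        Set (Fin n → ZMod 2)) hammingNorm t :=
  fun e he => leafE_sound h e he

/-- **Soundness of route E (`Z`-sector)** (rows exchanged). -/
theorem correctsUpToZ_of_checkRadiusE {n : ℕ} {HX HZ : List ℕ}
    (hcomm : Census.rowMatrix n HX * (Census.rowMatrix n HZ)ᵀ = 0) {T : List (ℕ × ℕ)}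
    {E : List (ℕ × List ℕ)} {t : ℕ} (h : checkRadiusE n HX HZ T E t = true) :
    (tableDecoder n HX.length T).CorrectsUpTo
      (CSSCode.ofMatrices (Census.rowMatrix n HX) (Census.rowMatrix n HZ) hcomm).zSyndrome
      ((CSSCode.ofMatrices (Census.rowMatrix n HX) (Census.rowMatrix n HZ) hcomm).rowSpZ :
        Set (Fin n → ZMod 2)) hammingNorm t :=
  correctsUpToX_of_checkRadiusE
    (CSSCode.ofMatrices (Census.rowMatrix n HX) (Census.rowMatrix n HZ) hcomm).swap.comm h

/-! ## Exactness: a certified failure one weight up -/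

/-- **Failure witness check** (`X`-sector form; exchange the row lists for `Z`): the error word `e`
(`< 2^n`) has weight `≤ t + 1`, and the witness `u` is orthogonal to every STABILIZER row
(`Census.synZero n Hstab u`, i.e. `Hstab u = 0`) and has ODD overlap with the residual `T(s) ⊕ e`,
`s` = the `Hsyn`-syndrome word of `e`; then the residual is not in the row space of `Hstab`
(`not_mem_rowSpace_of_witness`), i.e. this error is NOT corrected. -/
def checkFailX (n : ℕ) (Hsyn Hstab : List ℕ) (T : List (ℕ × ℕ)) (t e u : ℕ) : Bool :=
  (Census.popc n e).ble (t + 1) && (e < 2 ^ n : Bool) && Census.synZero n Hstab u &&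
    (Census.popc n (u &&& (((T.lookup (synWordOf n Hsyn e)).getD 0) ^^^ e)) % 2 == 1)

/-- **Soundness of the failure witness**: the table decoder does NOT correct every error of weight
`≤ t + 1` (for the CSS code with `X`-rows `HX = Hstab`, `Z`-rows `HZ = Hsyn`: the residual of the
`X`-error `ofBits n e` is outside the row space of `H^X`). -/
theorem not_correctsUpToX_of_checkFailX {n : ℕ} {HX HZ : List ℕ}
    (hcomm : Census.rowMatrix n HX * (Census.rowMatrix n HZ)ᵀ = 0) {T : List (ℕ × ℕ)} {t e u : ℕ}
    (h : checkFailX n HZ HX T t e u = true) :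
    ¬ (tableDecoder n HZ.length T).CorrectsUpTo
      (CSSCode.ofMatrices (Census.rowMatrix n HX) (Census.rowMatrix n HZ) hcomm).xSyndrome
      ((CSSCode.ofMatrices (Census.rowMatrix n HX) (Census.rowMatrix n HZ) hcomm).rowSpX :
        Set (Fin n → ZMod 2)) hammingNorm (t + 1) := by
  simp only [checkFailX, Bool.and_eq_true, Nat.ble_eq, decide_eq_true_eq, beq_iff_eq] at h
  obtain ⟨⟨⟨hwt, _⟩, hu⟩, hodd⟩ := h
  intro hD
  have hcorr := hD (Census.ofBits n e) (by rw [Census.hammingNorm_ofBits]; exact hwt)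
  rw [Decoder.corrects_iff, SetLike.mem_coe] at hcorr
  refine not_mem_rowSpace_of_witness (Census.ofBits n u) ((Census.synZero_iff _ _ _).1 hu) ?_ hcorr
  rw [CSSCode.xSyndrome_apply, tableDecoder, toBits_mulVec_ofBits, ← Census.ofBits_xor,
    Census.ofBits_dotProduct, Census.natCast_zmod2_ne_zero_iff]
  exact hodd

/-- **Exact radius, `X`-sector, route T**: passed table check at `t`, `2t < d^X`, and a certified
failure at weight `≤ t + 1` ⟹ the table decoder's correction radius is exactly `t`. -/
theorem isCorrectionRadiusX_of_checks {n : ℕ} {HX HZ : List ℕ}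
    (hcomm : Census.rowMatrix n HX * (Census.rowMatrix n HZ)ᵀ = 0) {T : List (ℕ × ℕ)} {t e u : ℕ}
    (hT : checkRadiusT n HZ T t = true)
    (hd : 2 * t < (CSSCode.ofMatrices (Census.rowMatrix n HX) (Census.rowMatrix n HZ) hcomm).dX)
    (hF : checkFailX n HZ HX T t e u = true) :
    (tableDecoder n HZ.length T).IsCorrectionRadius
      (CSSCode.ofMatrices (Census.rowMatrix n HX) (Census.rowMatrix n HZ) hcomm).xSyndrome
      ((CSSCode.ofMatrices (Census.rowMatrix n HX) (Census.rowMatrix n HZ) hcomm).rowSpX :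
        Set (Fin n → ZMod 2)) hammingNorm t :=
  ⟨correctsUpToX_of_checkRadiusT hcomm hT hd, not_correctsUpToX_of_checkFailX hcomm hF⟩

/-! ## Plugging a checked distance certificate -/

namespace DistCertRadius

open Census

/-- **Radius from a distance certificate + a table check (`X`-sector)**: for a checked distance
certificate `c` (so `(c.code _).dX = c.dX` in the kernel, `DistCert.dX_code`), a passed route-T table
check on the `Z`-rows and the numeric inequality `2t < c.dX` give: the table decoder corrects every
`X`-error of weight `≤ t` on `c.code`. -/
theorem correctsUpToX (c : Census.DistCert) (hc : c.checkDistCert = true) {T : List (ℕ × ℕ)}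
    {t : ℕ} (hT : checkRadiusT c.n c.HZ T t = true) (ht : 2 * t < c.dX) :
    (tableDecoder c.n c.HZ.length T).CorrectsUpTo (c.code (c.commOK_of_check hc)).xSyndrome
      ((c.code (c.commOK_of_check hc)).rowSpX : Set (Fin c.n → ZMod 2)) hammingNorm t :=
  correctsUpToX_of_checkRadiusT _ hT (by have h' := c.dX_code hc; rw [← h'] at ht; exact ht)

/-- **Radius from a distance certificate + a table check (`Z`-sector).** -/
theorem correctsUpToZ (c : Census.DistCert) (hc : c.checkDistCert = true) {T : List (ℕ × ℕ)}
    {t : ℕ} (hT : checkRadiusT c.n c.HX T t = true) (ht : 2 * t < c.dZ) :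
    (tableDecoder c.n c.HX.length T).CorrectsUpTo (c.code (c.commOK_of_check hc)).zSyndrome
      ((c.code (c.commOK_of_check hc)).rowSpZ : Set (Fin c.n → ZMod 2)) hammingNorm t :=
  correctsUpToZ_of_checkRadiusT _ hT (by have h' := c.dZ_code hc; rw [← h'] at ht; exact ht)

end DistCertRadius

/-! ## Control: the `[[4,2,2]]` code detects but corrects nothing (`t = 0`) — pipeline smoke test -/

/-- Route T for the `[[4,2,2]]` control (`HX = HZ = [1111]`), trivial table, `t = 0`: passes
(tier KERNEL, `decide`). -/
theorem checkRadiusT_C422 : checkRadiusT Census.certC422.n Census.certC422.HZ [] 0 = true := by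
  decide

/-- The trivial decoder corrects every `X`-error of weight `≤ 0` on the `[[4,2,2]]` control code of
`Census/CertCheck.lean` (tier KERNEL, `decide`; `2·0 < dX = 2` read off the distance certificate) —
the radius pipeline end to end on the smallest control. -/
theorem correctsUpToX_C422 :
    (tableDecoder Census.certC422.n Census.certC422.HZ.length []).CorrectsUpTo
      (Census.certC422.code (Census.certC422.commOK_of_check Census.checkDistCert_certC422)).xSyndrome
      ((Census.certC422.code
          (Census.certC422.commOK_of_check Census.checkDistCert_certC422)).rowSpX :
        Set (Fin Census.certC422.n → ZMod 2)) hammingNorm 0 :=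
  DistCertRadius.correctsUpToX Census.certC422 Census.checkDistCert_certC422 checkRadiusT_C422
    (by decide)

end Summit.Ventures.QEC.Decoders
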